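import Mathlib
import Summits.CriticalPhenomena.CardyFormulaZ2.Theorems.CardySelfRefinementDefs
import Summits.CriticalPhenomena.CardyFormulaZ2.Theorems.CardySelfRefinementGradientComparabilityStubCornerWindowsDefectBoundary
import Summits.CriticalPhenomena.CardyFormulaZ2.Theorems.CardySelfRefinementGradientComparabilityStubSlopeBoundsCornerPenaltySum
import Summits.CriticalPhenomena.CardyFormulaZ2.Theorems.CardySelfRefinementGradientComparabilityStubDcEqSumPivotal
import Summits.CriticalPhenomena.CardyFormulaZ2.Theorems.CardySelfRefinementGradientComparabilityKernelsDictionary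
import HarnessLib

/-!
# Crux `GradientComparability` (stmt-CriticalPhenomena-10269), line `monotone-product-coordinates` —
# support for stub `stub_cornerWindows`, part 6: hypothesis (D1) on the enhancement slice `ρ = 1`
# reduced to its boundary layer, the confinement of the band and the slope bound in pivotal currency

Route `CardySelfRefinement`, sub-problem `CriticalPhenomena/CardyFormulaZ2`; vocabulary from
`CardySelfRefinementDefs` (`ax tb M Aloc P Dc window coinWindow edgeOf`); part 3
(`cornerWindow_rho1_of_pivotalWindow_of_defectBound : (K1) → (D1) → h1`), part 5
(`…StubCornerWindowsDefectBoundary`: the bundle-by-bundle splitting `T = N + T′`,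
`sum_sum_powerset_eq_pivotal_add_proper`, and its `{c = 0}` form `sum_sum_powerset_eq_of_far_c0`),
the bulk penalty bound of the corner dictionary (`…StubSlopeBoundsCornerPenaltySum`:
`sum_defect_le_of_far`) and the Russo dictionary in the `c`-direction (`stub_Dc_eq_sum_pivotal`).

## Mathematics

Notation of parts 3 and 5 (`N`, `T`, `T′ = T − N` = the proper-pattern defect, near / far selector
coins at radius `2η`).  Hypothesis (D1) of the assembly reads `2^{-k} T(1,c) ≤ θ N(1,c)`, `θ < ½`, at
the band points `(1, c)` of the slice `ρ = 1` and at the corner `(1, 0)`.  On this slice the interior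
edges are open with probability `c > 0`, so the far part of `T′` does NOT vanish (no analogue of brick
S2); instead `T = N + T′_near + T′_far` (part 5) and

* (D1∂) `2^{-k} T′_near(1,c) ≤ θ′ N(1,c)`, `θ′ < ½ − 2^{-k}`, at the band points and at the corner
  (one clause: `c = 0 ∨ P(1,c) ∈ [vlo,vhi]`) — the boundary-layer count, as on the slice `c = 0`;
* (D1o) `2^{-k} T′_far(1,c) ≤ ε N(1,c)` at the band points for every `ε > 0` once `η < η₁(ε)` — the
  far proper defect is `o(N)` on the band;

give (D1) with `θ = θ′ + 2^{-k} + ε`, `ε = (½ − 2^{-k} − θ′)/2`; at the corner `c = 0` brick S2 applies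
and (D1∂) alone suffices (`defectBound_rho1_of_boundaryDefectBound_of_farDefectSmall`, registered).

(D1o) in turn is bookkeeping over two inputs of the corner analysis.  By `sum_defect_le_of_far`
(local modification at the interior vertices of a far bundle, finite energy `1/(1−c)` per closed
interior coin) and `stub_Dc_eq_sum_pivotal`, for `0 ≤ c < 1` and far `S`:
`T′_S(1,c) ≤ c · ( 2(k−1)(2^k−1)/(1−c) · N_S(1,c) + 2^{k+2}(2^k−1) · ∂cP(1,c) )`.  Hence (D1o) follows
from
* (D1c) the band of the slice shrinks into the corner, `sup {c : P(1,c) ∈ [vlo,vhi]} → 0` as `η → 0`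
  — which IS the confinement (CONF) (hypothesis 2 of `slopeBounds_corner_of_localSlope_of_confinement`,
  conclusion of `cornerConfinement_of_hardWayBoxes`) read at `ρ = 1`: `P(1,c₀) > vhi` for `η < η₁(c₀)`
  and `P` is monotone in `c` (`cRange_rho1_of_cornerConfinement`, registered) —, and
* (D1∇) on the band of the slice `∂cP(1,c) ≤ C · N(1,c)` (the local slope bound (LOC)
  `|∂cP| ≤ C |∂ρP|` at `ρ = 1`, `c ≤ c₀`, combined with `|∂ρP| ≤ ½ N` of part 2 and (D1c)),

with `η₁(ε)` chosen through `c ≤ ε′ = min (½, ε/(A+1))`,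
`A = 2^{-k}(4(k−1)(2^k−1) + 2^{k+2}(2^k−1) C₊)` (`farDefectSmall_rho1_of_cRange_of_DcBound`,
registered).  So (D1) ⟸ (D1∂) ∧ (D1c) ∧ (D1∇): beyond the two corner inputs (LOC), (HWB) already
isolated by `stub_slopeBounds`, only the boundary-layer count (D1∂) remains.  Pure bookkeeping; no
percolation estimate and no named fact is used here.
-/

noncomputable section

namespace Summit.CriticalPhenomena.CardyFormulaZ2.Theorems.CardySelfRefinement

open scoped Topology
open Filter Set MeasureTheory
open Literature.Probability.LatticeModels Literature.Probability.Percolation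
open Literature.Probability.Percolation.QuadCrossing
open Summit.CriticalPhenomena.CardyFormulaZ2.Theses.CardySelfRefinement

/-- **(CONF) ⟹ (D1c)** (registered helper of `stub_cornerWindows`): the corner confinement — for every
`c₀ > 0`, `P(ρ, c₀) > v` eventually in the mesh, uniformly for `ρ` near `1` — read at `ρ = 1` together with
the monotonicity of `P` in `c` confines the band of the slice `ρ = 1` to `c ≤ ε`, any `ε > 0`, for small mesh. -/
theorem cRange_rho1_of_cornerConfinement : (∀ k : ℕ, k = 2 ∨ k = 3 → ∀ (m : ℕ) (F : Fin m → Quad (Set.univ : Set ℂ)), 0 < m → ∀ c₀ : ℝ, 0 < c₀ → ∃ δ : ℝ, 0 < δ ∧ ∀ v : ℝ, v < 1 → ∃ η₁ : ℝ, 0 < η₁ ∧ ∀ η ∈ Set.Ioo 0 η₁, ∀ ρ ∈ Set.Icc (1 - 2 * δ) 1, v < P k m F η ρ c₀) → ∀ k : ℕ, k = 2 ∨ k = 3 → ∀ (m : ℕ) (F : Fin m → Quad (Set.univ : Set ℂ)), 0 < m → ∀ vlo vhi : ℝ, 0 < vlo → vlo < vhi → vhi < 1 → ∀ ε : ℝ,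 0 < ε → ∃ η₁ : ℝ, 0 < η₁ ∧ ∀ η ∈ Set.Ioo 0 η₁, ∀ c ∈ Set.Icc (0 : ℝ) 1, P k m F η 1 c ∈ Set.Icc vlo vhi → c ≤ ε := by
  intro HC k hk m F hm vlo vhi _ _ hvhi ε hε
  obtain ⟨δ, hδ, Hv⟩ := HC k hk m F hm ε hε
  obtain ⟨η₁, hη₁, H⟩ := Hv vhi hvhi
  refine ⟨η₁, hη₁, fun η hη c _ hband => ?_⟩
  by_contra hlt
  have h1 : (1 : ℝ) ∈ Set.Icc (1 - 2 * δ) 1 := ⟨by linarith, le_rfl⟩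
  have hP := H η hη 1 h1
  have hmono := P_mono_c k m F hη.1.ne' 1 (not_le.1 hlt).le
  linarith [hband.2]

/-- **(D1c) ⟹ (D1∇) ⟹ (D1o)** (registered helper of `stub_cornerWindows`): if on the slice `ρ = 1` the
band `{c : P(1,c) ∈ [vlo,vhi]}` shrinks into the corner as `η → 0` and `∂cP(1,c) ≤ C · N(1,c)` on it, then
the proper-pattern defect of the FAR bundles (all `k + 1` canonical vertices at drawn distance `≥ 2η` from
every side of every quad) is `o(N)` on the band: for every `ε > 0`, `2^{-k} T′_far(1,c) ≤ ε N(1,c)` once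
`η < η₁(ε)`.  From `sum_defect_le_of_far` (factor `c`) and `stub_Dc_eq_sum_pivotal`. -/
theorem farDefectSmall_rho1_of_cRange_of_DcBound : (∀ k : ℕ, k = 2 ∨ k = 3 → ∀ (m : ℕ) (F : Fin m → Quad (Set.univ : Set ℂ)), 0 < m → ∀ vlo vhi : ℝ, 0 < vlo → vlo < vhi → vhi < 1 → ∀ ε : ℝ, 0 < ε → ∃ η₁ : ℝ, 0 < η₁ ∧ ∀ η ∈ Set.Ioo 0 η₁, ∀ c ∈ Set.Icc (0 : ℝ) 1, P k m F η 1 c ∈ Set.Icc vlo vhi → c ≤ ε) → (∀ k : ℕ, k = 2 ∨ k = 3 → ∀ (m : ℕ) (F : Fin m → Quad (Set.univ : Set ℂ)), 0 < m → ∀ vlo vhi : ℝ, 0 < vlo → vlo < vhi → vhi < 1 → ∃ C η₁ : ℝ, 0 < η₁ ∧ ∀ η ∈ Set.Ioo 0 η₁, ∀ K : Finset (Site 2 × Fin 2 × Fin 3), (↑K : Set (Site 2 × Fin 2 × Fin 3)) = coinWindow k (window m F η) → ∀ c ∈ Set.Icc (0 : ℝ) 1, P k m F η 1 c ∈ Set.Icc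 vlo vhi → Dc k m F η (1, c) ≤ C * ∑ i ∈ K with i.2.2 = 2, (M k 1 c).real {ω | ω ∪ edgeOf '' {vd : Site 2 × Fin 2 | ax k vd ∧ tb k vd = i.1 ∧ vd.2 = i.2.1} ∈ Aloc m F η ∧ ω \ edgeOf '' {vd : Site 2 × Fin 2 | ax k vd ∧ tb k vd = i.1 ∧ vd.2 = i.2.1} ∉ Aloc m F η}) → ∀ k : ℕ, k = 2 ∨ k = 3 → ∀ (m : ℕ) (F : Fin m → Quad (Set.univ : Set ℂ)), 0 < m → ∀ vlo vhi : ℝ, 0 < vlo → vlo < vhi → vhi < 1 → ∀ ε : ℝ, 0 < ε → ∃ η₁ : ℝ, 0 < η₁ ∧ ∀ η ∈ Set.Ioo 0 η₁, ∀ K : Finset (Site 2 × Fin 2 × Fin 3), (↑K : Set (Site 2 × Fin 2 × Fin 3)) = coinWindow k (window m F η) → ∀ S : Finset (Site 2 × Fin 2 × Fin 3), S ⊆ K.filter (fun i => i.2.2 = 2) → (∀ i ∈ S, ∀ j : ℕ, j ≤ k → ∀ (a : Fin m) (b : Fin 4), ∀ q ∈ (F a).side b, 2 * η ≤ dist ((η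 : ℂ) * squareLatticeEmbedding.z (fun l => (k : ℤ) * i.1 l + if l = i.2.1 then (j : ℤ) else 0)) q) → ∀ c ∈ Set.Icc (0 : ℝ) 1, P k m F η 1 c ∈ Set.Icc vlo vhi → (1 / 2) ^ k * ∑ i ∈ S, ∑ J ∈ ((Finset.range k).powerset).erase (Finset.range k), (M k 1 c).real ({ω | ω \ edgeOf '' {vd : Site 2 × Fin 2 | ax k vd ∧ tb k vd = i.1 ∧ vd.2 = i.2.1} ∪ ↑(J.image fun j : ℕ => edgeOf ((fun l => (k : ℤ) * i.1 l + if l = i.2.1 then (j : ℤ) else 0), i.2.1)) ∈ Aloc m F η} \ {ω | ω \ edgeOf '' {vd : Site 2 × Fin 2 | ax k vd ∧ tb k vd = i.1 ∧ vd.2 = i.2.1} ∈ Aloc m F η}) ≤ ε * ∑ i ∈ K with i.2.2 = 2, (M k 1 c).real {ω | ω ∪ edgeOf '' {vd : Site 2 × Fin 2 | ax k vd ∧ tb k vd = i.1 ∧ vd.2 = i.2.1} ∈ Aloc m F η ∧ ω \ edgeOf '' {vd : Site 2 × Fin 2 | ax k vd ∧ tb k vd = i.1 ∧ vd.2 = i.2.1}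 ∉ Aloc m F η} := by
  intro HC HD k hk m F hm vlo vhi hvlo hvv hvhi ε hε
  classical
  have hkpos : 0 < k := by rcases hk with rfl | rfl <;> norm_num
  obtain ⟨C, ηD, hηD, HDc⟩ := HD k hk m F hm vlo vhi hvlo hvv hvhi
  -- the constants
  have hk1 : (0 : ℝ) ≤ (k : ℝ) - 1 := by
    have h : (1 : ℝ) ≤ k := by exact_mod_cast hkpos
    linarith
  have hq : (0 : ℝ) ≤ 2 ^ k - 1 := by
    have h : (1 : ℝ) ≤ 2 ^ k := one_le_pow₀ (by norm_num)
    linarith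
  obtain ⟨X, hX_def⟩ : ∃ X : ℝ, X = 2 * ((k : ℝ) - 1) * (2 ^ k - 1) := ⟨_, rfl⟩
  obtain ⟨Y, hY_def⟩ : ∃ Y : ℝ, Y = 2 ^ (k + 2) * (2 ^ k - 1) := ⟨_, rfl⟩
  have hX : 0 ≤ X := by rw [hX_def]; exact mul_nonneg (mul_nonneg (by norm_num) hk1) hq
  have hY : 0 ≤ Y := by rw [hY_def]; exact mul_nonneg (by positivity) hq
  have hp : (0 : ℝ) ≤ (1 / 2) ^ k := by positivity
  obtain ⟨A, hA_def⟩ : ∃ A : ℝ, A = (1 / 2) ^ k * (2 * X + Y * max C 0) := ⟨_, rfl⟩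
  have hA : 0 ≤ A := by
    rw [hA_def]
    exact mul_nonneg hp (add_nonneg (by linarith) (mul_nonneg hY (le_max_right _ _)))
  obtain ⟨ε', hε'_def⟩ : ∃ ε' : ℝ, ε' = min (1 / 2) (ε / (A + 1)) := ⟨_, rfl⟩
  have hε' : 0 < ε' := by rw [hε'_def]; exact lt_min (by norm_num) (by positivity)
  have hε'A : ε' * A ≤ ε := by
    calc ε' * A ≤ ε / (A + 1) * A := mul_le_mul_of_nonneg_right (hε'_def ▸ min_le_right _ _) hA
      _ ≤ ε := by
          rw [div_mul_eq_mul_div, div_le_iff₀ (by linarith)]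
          nlinarith
  obtain ⟨ηC, hηC, HCc⟩ := HC k hk m F hm vlo vhi hvlo hvv hvhi ε' hε'
  refine ⟨min ηC ηD, lt_min hηC hηD, fun η hη K hK S hS hSfar c hc hband => ?_⟩
  have hη0 : 0 < η := hη.1
  have hηne : η ≠ 0 := hη0.ne'
  have hηC' : η ∈ Set.Ioo 0 ηC := ⟨hη0, hη.2.trans_le (min_le_left _ _)⟩
  have hηD' : η ∈ Set.Ioo 0 ηD := ⟨hη0, hη.2.trans_le (min_le_right _ _)⟩
  have hcε : c ≤ ε' := HCc η hηC' c hc hband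
  have hc12 : c ≤ 1 / 2 := hcε.trans (hε'_def ▸ min_le_left _ _)
  have hc0 : 0 ≤ c := hc.1
  have hcIco : c ∈ Set.Ico (0 : ℝ) 1 := ⟨hc0, by linarith⟩
  -- the non-axial window edges and the Russo dictionary in the `c`-direction
  have hfin : (window m F η).Finite := window_finite m F hηne
  obtain ⟨Wn, hWn_def⟩ : ∃ Wn : Finset (Sym2 (Site 2)), Wn = hfin.toFinset.filter
      (fun e => ∃ (v : Site 2) (d : Fin 2), e = edgeOf (v, d) ∧ ¬ ax k (v, d)) := ⟨_, rfl⟩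
  have hWn : ∀ e, e ∈ Wn ↔ e ∈ window m F η ∧
      ∃ (v : Site 2) (d : Fin 2), e = edgeOf (v, d) ∧ ¬ ax k (v, d) := fun e => by
    rw [hWn_def, Finset.mem_filter, Set.Finite.mem_toFinset]
  have hDc : Dc k m F η (1, c) = ∑ e ∈ Wn, (M k 1 c).real {ω | IsPivotal (Aloc m F η) e ω} :=
    stub_Dc_eq_sum_pivotal k m F hηne 1 hc Wn hWn
  -- the bulk penalty bound with radius `2η`
  have hsel : ∀ i ∈ S, i.2.2 = 2 := fun i hi => (Finset.mem_filter.1 (hS hi)).2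
  have hmain := sum_defect_le_of_far k m hkpos F η (2 * η) hη0 le_rfl 1 c hcIco Wn hWn S hsel
    fun i hi j _ hjk => hSfar i hi j hjk.le
  rw [← hDc] at hmain
  have hDcN := HDc η hηD' K hK c hc hband
  -- abbreviations
  obtain ⟨Pv, hPv⟩ : ∃ Pv : Site 2 × Fin 2 × Fin 3 → ℝ, ∀ i, (M k 1 c).real {ω | ω ∪
      edgeOf '' {vd : Site 2 × Fin 2 | ax k vd ∧ tb k vd = i.1 ∧ vd.2 = i.2.1} ∈ Aloc m F η ∧ ω \
      edgeOf '' {vd : Site 2 × Fin 2 | ax k vd ∧ tb k vd = i.1 ∧ vd.2 = i.2.1} ∉ Aloc m F η} = Pv i :=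
    ⟨_, fun _ => rfl⟩
  obtain ⟨Df, hDf⟩ : ∃ Df : Site 2 × Fin 2 × Fin 3 → ℝ, ∀ i,
      ∑ J ∈ ((Finset.range k).powerset).erase (Finset.range k), (M k 1 c).real
        ({ω | ω \ edgeOf '' {vd : Site 2 × Fin 2 | ax k vd ∧ tb k vd = i.1 ∧ vd.2 = i.2.1} ∪
          ↑(J.image fun j : ℕ => edgeOf ((fun l => (k : ℤ) * i.1 l + if l = i.2.1 then (j : ℤ) else 0),
            i.2.1)) ∈ Aloc m F η} \ {ω | ω \ edgeOf '' {vd : Site 2 × Fin 2 | ax k vd ∧ tb k vd = i.1 ∧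
          vd.2 = i.2.1} ∈ Aloc m F η}) = Df i := ⟨_, fun _ => rfl⟩
  have hPv0 : ∀ i, 0 ≤ Pv i := fun i => by rw [← hPv]; exact measureReal_nonneg
  simp only [hPv, hDf] at hmain hDcN ⊢
  rw [← hX_def, ← hY_def] at hmain
  -- arithmetic
  have hN : 0 ≤ ∑ i ∈ K with i.2.2 = 2, Pv i := Finset.sum_nonneg fun i _ => hPv0 i
  have hNS0 : 0 ≤ ∑ i ∈ S, Pv i := Finset.sum_nonneg fun i _ => hPv0 i
  have hNS : ∑ i ∈ S, Pv i ≤ ∑ i ∈ K with i.2.2 = 2, Pv i :=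
    Finset.sum_le_sum_of_subset_of_nonneg hS fun i _ _ => hPv0 i
  have hD : Dc k m F η (1, c) ≤ max C 0 * ∑ i ∈ K with i.2.2 = 2, Pv i :=
    hDcN.trans (mul_le_mul_of_nonneg_right (le_max_left _ _) hN)
  have h1c : X / (1 - c) ≤ 2 * X := by
    rw [div_le_iff₀ (by linarith)]
    nlinarith [mul_nonneg hX (by linarith : (0 : ℝ) ≤ 1 - 2 * c)]
  have hinner : X / (1 - c) * ∑ i ∈ S, Pv i + Y * Dc k m F η (1, c) ≤
      (2 * X + Y * max C 0) * ∑ i ∈ K with i.2.2 = 2, Pv i := by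
    have h1 : X / (1 - c) * ∑ i ∈ S, Pv i ≤ 2 * X * ∑ i ∈ K with i.2.2 = 2, Pv i :=
      mul_le_mul h1c hNS hNS0 (by linarith)
    have h2 : Y * Dc k m F η (1, c) ≤ Y * (max C 0 * ∑ i ∈ K with i.2.2 = 2, Pv i) :=
      mul_le_mul_of_nonneg_left hD hY
    linarith
  have hL : ∑ i ∈ S, Df i ≤ c * ((2 * X + Y * max C 0) * ∑ i ∈ K with i.2.2 = 2, Pv i) :=
    hmain.trans (mul_le_mul_of_nonneg_left hinner hc0)
  have hB : 0 ≤ (2 * X + Y * max C 0) * ∑ i ∈ K with i.2.2 = 2, Pv i :=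
    mul_nonneg (by linarith [mul_nonneg hY (le_max_right C 0)]) hN
  calc (1 / 2 : ℝ) ^ k * ∑ i ∈ S, Df i
      ≤ (1 / 2) ^ k * (c * ((2 * X + Y * max C 0) * ∑ i ∈ K with i.2.2 = 2, Pv i)) :=
        mul_le_mul_of_nonneg_left hL hp
    _ ≤ (1 / 2) ^ k * (ε' * ((2 * X + Y * max C 0) * ∑ i ∈ K with i.2.2 = 2, Pv i)) :=
        mul_le_mul_of_nonneg_left (mul_le_mul_of_nonneg_right hcε hB) hp
    _ = ε' * A * ∑ i ∈ K with i.2.2 = 2, Pv i := by rw [hA_def]; ring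
    _ ≤ ε * ∑ i ∈ K with i.2.2 = 2, Pv i := mul_le_mul_of_nonneg_right hε'A hN

/-- **(D1∂) ⟹ (D1o) ⟹ (D1)** (registered reduction of `stub_cornerWindows`, wave 5): hypothesis (D1) of
`cornerWindow_rho1_of_pivotalWindow_of_defectBound` — on the slice `ρ = 1`, at the band points and at the corner,
`2^{-k} Σ_B Σ_{J ⊆ [k]} M(A_B^J ∖ A_B^∅) ≤ θ · Σ_B M(B set-pivotal)` with `θ < ½` — FOLLOWS from (D1∂) its
boundary-layer form (the double sum restricted to the proper patterns of the NEAR bundles, `θ′ < ½ − 2^{-k}`, band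
points and corner) and (D1o) the far proper defect being `o(N)` on the band.  Proof: `T = N + T′_near + T′_far`
bundle by bundle; on the band `2^{-k} T ≤ (2^{-k} + θ′ + ε) N` with `ε = (½ − 2^{-k} − θ′)/2`; at the corner
`c = 0` brick S2 removes `T′_far`. -/
theorem defectBound_rho1_of_boundaryDefectBound_of_farDefectSmall : (∀ k : ℕ, k = 2 ∨ k = 3 → ∀ (m : ℕ) (F : Fin m → Quad (Set.univ : Set ℂ)), 0 < m → ∀ vlo vhi : ℝ, 0 < vlo → vlo < vhi → vhi < 1 → ∃ θ η₁ : ℝ, θ < 1 / 2 - (1 / 2) ^ k ∧ 0 < η₁ ∧ ∀ η ∈ Set.Ioo 0 η₁, ∀ K : Finset (Site 2 × Fin 2 × Fin 3), (↑K : Set (Site 2 × Fin 2 × Fin 3)) = coinWindow k (window m F η) → ∀ S ⊆ K.filter (·.2.2 = 2), (∀ i ∈ S, ∃ j, j ≤ k ∧ ∃ a b, ∃ q ∈ (F a).side b, dist ((η : ℂ) * squareLatticeEmbedding.z (fun l => (k : ℤ) * i.1 l + if l = i.2.1 then (j : ℤ) else 0)) q < 2 * η) → ∀ c ∈ Set.Icc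 (0 : ℝ) 1, c = 0 ∨ P k m F η 1 c ∈ Set.Icc vlo vhi → (1 / 2) ^ k * ∑ i ∈ S, ∑ J ∈ (Finset.range k).powerset.erase (Finset.range k), (M k 1 c).real ({ω | ω \ edgeOf '' {vd | ax k vd ∧ tb k vd = i.1 ∧ vd.2 = i.2.1} ∪ ↑(J.image fun j : ℕ => edgeOf ((fun l => (k : ℤ) * i.1 l + if l = i.2.1 then (j : ℤ) else 0), i.2.1)) ∈ Aloc m F η} \ {ω | ω \ edgeOf '' {vd | ax k vd ∧ tb k vd = i.1 ∧ vd.2 = i.2.1} ∈ Aloc m F η}) ≤ θ * ∑ i ∈ K with i.2.2 = 2, (M k 1 c).real {ω | ω ∪ edgeOf '' {vd | ax k vd ∧ tb k vd = i.1 ∧ vd.2 = i.2.1} ∈ Aloc m F η ∧ ω \ edgeOf '' {vd | ax k vd ∧ tb k vd = i.1 ∧ vd.2 = i.2.1} ∉ Aloc m F η}) → (∀ k : ℕ, k = 2 ∨ k = 3 → ∀ (m : ℕ) (F : Fin m → Quad (Set.univ : Set ℂ)), 0 < m → ∀ vlo vhi : ℝ, 0 < vlo → vlo < vhi → vhi <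 1 → ∀ ε : ℝ, 0 < ε → ∃ η₁ : ℝ, 0 < η₁ ∧ ∀ η ∈ Set.Ioo 0 η₁, ∀ K : Finset (Site 2 × Fin 2 × Fin 3), (↑K : Set (Site 2 × Fin 2 × Fin 3)) = coinWindow k (window m F η) → ∀ S : Finset (Site 2 × Fin 2 × Fin 3), S ⊆ K.filter (fun i => i.2.2 = 2) → (∀ i ∈ S, ∀ j : ℕ, j ≤ k → ∀ (a : Fin m) (b : Fin 4), ∀ q ∈ (F a).side b, 2 * η ≤ dist ((η : ℂ) * squareLatticeEmbedding.z (fun l => (k : ℤ) * i.1 l + if l = i.2.1 then (j : ℤ) else 0)) q) → ∀ c ∈ Set.Icc (0 : ℝ) 1, P k m F η 1 c ∈ Set.Icc vlo vhi → (1 / 2) ^ k * ∑ i ∈ S, ∑ J ∈ ((Finset.range k).powerset).erase (Finset.range k), (M k 1 c).real ({ω | ω \ edgeOf '' {vd : Site 2 × Fin 2 | ax k vd ∧ tb k vd = i.1 ∧ vd.2 = i.2.1} ∪ ↑(J.image fun j : ℕ => edgeOf ((fun l => (k : ℤ) * i.1 l + if l = i.2.1 then (j : ℤ) else 0), i.2.1))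 ∈ Aloc m F η} \ {ω | ω \ edgeOf '' {vd : Site 2 × Fin 2 | ax k vd ∧ tb k vd = i.1 ∧ vd.2 = i.2.1} ∈ Aloc m F η}) ≤ ε * ∑ i ∈ K with i.2.2 = 2, (M k 1 c).real {ω | ω ∪ edgeOf '' {vd : Site 2 × Fin 2 | ax k vd ∧ tb k vd = i.1 ∧ vd.2 = i.2.1} ∈ Aloc m F η ∧ ω \ edgeOf '' {vd : Site 2 × Fin 2 | ax k vd ∧ tb k vd = i.1 ∧ vd.2 = i.2.1} ∉ Aloc m F η}) → ∀ k : ℕ, k = 2 ∨ k = 3 → ∀ (m : ℕ) (F : Fin m → Quad (Set.univ : Set ℂ)), 0 < m → ∀ vlo vhi : ℝ, 0 < vlo → vlo < vhi → vhi < 1 → ∃ θ η₁ : ℝ, θ < 1 / 2 ∧ 0 < η₁ ∧ ∀ η ∈ Set.Ioo 0 η₁, ∀ K : Finset (Site 2 × Fin 2 × Fin 3), (↑K : Set (Site 2 × Fin 2 × Fin 3)) = coinWindow k (window m F η) → (∀ c ∈ Set.Icc (0 : ℝ) 1, P k m F η 1 c ∈ Set.Icc vlo vhi → (1 / 2) ^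 k * ∑ i ∈ K with i.2.2 = 2, ∑ J ∈ (Finset.range k).powerset, (M k 1 c).real ({ω | ω \ edgeOf '' {vd : Site 2 × Fin 2 | ax k vd ∧ tb k vd = i.1 ∧ vd.2 = i.2.1} ∪ ↑(J.image fun j : ℕ => edgeOf ((fun l => (k : ℤ) * i.1 l + if l = i.2.1 then (j : ℤ) else 0), i.2.1)) ∈ Aloc m F η} \ {ω | ω \ edgeOf '' {vd : Site 2 × Fin 2 | ax k vd ∧ tb k vd = i.1 ∧ vd.2 = i.2.1} ∈ Aloc m F η}) ≤ θ * ∑ i ∈ K with i.2.2 = 2, (M k 1 c).real {ω | ω ∪ edgeOf '' {vd : Site 2 × Fin 2 | ax k vd ∧ tb k vd = i.1 ∧ vd.2 = i.2.1} ∈ Aloc m F η ∧ ω \ edgeOf '' {vd : Site 2 × Fin 2 | ax k vd ∧ tb k vd = i.1 ∧ vd.2 = i.2.1} ∉ Aloc m F η}) ∧ (1 / 2) ^ k * ∑ i ∈ K with i.2.2 = 2, ∑ J ∈ (Finset.range k).powerset, (M k 1 0).real ({ω | ω \ edgeOf '' {vd : Site 2 × Fin 2 | ax k vd ∧ tb k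 vd = i.1 ∧ vd.2 = i.2.1} ∪ ↑(J.image fun j : ℕ => edgeOf ((fun l => (k : ℤ) * i.1 l + if l = i.2.1 then (j : ℤ) else 0), i.2.1)) ∈ Aloc m F η} \ {ω | ω \ edgeOf '' {vd : Site 2 × Fin 2 | ax k vd ∧ tb k vd = i.1 ∧ vd.2 = i.2.1} ∈ Aloc m F η}) ≤ θ * ∑ i ∈ K with i.2.2 = 2, (M k 1 0).real {ω | ω ∪ edgeOf '' {vd : Site 2 × Fin 2 | ax k vd ∧ tb k vd = i.1 ∧ vd.2 = i.2.1} ∈ Aloc m F η ∧ ω \ edgeOf '' {vd : Site 2 × Fin 2 | ax k vd ∧ tb k vd = i.1 ∧ vd.2 = i.2.1} ∉ Aloc m F η} := by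
  intro HB HF k hk m F hm vlo vhi hvlo hvv hvhi
  classical
  have hkpos : 0 < k := by rcases hk with rfl | rfl <;> norm_num
  obtain ⟨θ, ηB, hθ, hηB, Hθ⟩ := HB k hk m F hm vlo vhi hvlo hvv hvhi
  obtain ⟨ε, hε_def⟩ : ∃ ε : ℝ, ε = (1 / 2 - (1 / 2) ^ k - θ) / 2 := ⟨_, rfl⟩
  have hε : 0 < ε := by rw [hε_def]; linarith
  obtain ⟨ηF, hηF, HFε⟩ := HF k hk m F hm vlo vhi hvlo hvv hvhi ε hε
  refine ⟨θ + (1 / 2) ^ k + ε, min ηB ηF, by rw [hε_def]; linarith, lt_min hηB hηF, fun η hη K hK => ?_⟩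
  have hη0 : 0 < η := hη.1
  have hηB' : η ∈ Set.Ioo 0 ηB := ⟨hη0, hη.2.trans_le (min_le_left _ _)⟩
  have hηF' : η ∈ Set.Ioo 0 ηF := ⟨hη0, hη.2.trans_le (min_le_right _ _)⟩
  -- the near / far splitting of the selector coins of the window
  obtain ⟨S, hS_def⟩ : ∃ S : Finset (Site 2 × Fin 2 × Fin 3), S = (K.filter fun i => i.2.2 = 2).filter
      fun i => ∃ j : ℕ, j ≤ k ∧ ∃ (a : Fin m) (b : Fin 4), ∃ q ∈ (F a).side b,
        dist ((η : ℂ) * squareLatticeEmbedding.z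
          (fun l => (k : ℤ) * i.1 l + if l = i.2.1 then (j : ℤ) else 0)) q < 2 * η := ⟨_, rfl⟩
  obtain ⟨Sf, hSf_def⟩ : ∃ Sf : Finset (Site 2 × Fin 2 × Fin 3), Sf = (K.filter fun i => i.2.2 = 2).filter
      fun i => ¬ ∃ j : ℕ, j ≤ k ∧ ∃ (a : Fin m) (b : Fin 4), ∃ q ∈ (F a).side b,
        dist ((η : ℂ) * squareLatticeEmbedding.z
          (fun l => (k : ℤ) * i.1 l + if l = i.2.1 then (j : ℤ) else 0)) q < 2 * η := ⟨_, rfl⟩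
  have hSsub : S ⊆ K.filter fun i => i.2.2 = 2 := by
    rw [hS_def]; exact Finset.filter_subset _ _
  have hSfsub : Sf ⊆ K.filter fun i => i.2.2 = 2 := by
    rw [hSf_def]; exact Finset.filter_subset _ _
  have hSnear : ∀ i ∈ S, ∃ j : ℕ, j ≤ k ∧ ∃ (a : Fin m) (b : Fin 4), ∃ q ∈ (F a).side b,
      dist ((η : ℂ) * squareLatticeEmbedding.z
        (fun l => (k : ℤ) * i.1 l + if l = i.2.1 then (j : ℤ) else 0)) q < 2 * η := fun i hi => by
    rw [hS_def] at hi
    exact (Finset.mem_filter.1 hi).2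
  have hSffar : ∀ i ∈ Sf, ∀ j : ℕ, j ≤ k → ∀ (a : Fin m) (b : Fin 4), ∀ q ∈ (F a).side b,
      2 * η ≤ dist ((η : ℂ) * squareLatticeEmbedding.z
        (fun l => (k : ℤ) * i.1 l + if l = i.2.1 then (j : ℤ) else 0)) q := by
    intro i hi j hj a b q hq
    rw [hSf_def] at hi
    exact not_lt.1 fun hlt => (Finset.mem_filter.1 hi).2 ⟨j, hj, a, b, q, hq, hlt⟩
  have hfar : ∀ i ∈ K.filter (fun i => i.2.2 = 2), i ∉ S → ∀ j : ℕ, j ≤ k → ∀ (a : Fin m) (b : Fin 4),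
      ∀ q ∈ (F a).side b, 2 * η ≤ dist ((η : ℂ) * squareLatticeEmbedding.z
        (fun l => (k : ℤ) * i.1 l + if l = i.2.1 then (j : ℤ) else 0)) q := by
    intro i hi hiS j hj a b q hq
    by_contra hlt
    refine hiS ?_
    rw [hS_def]
    exact Finset.mem_filter.2 ⟨hi, j, hj, a, b, q, hq, not_le.1 hlt⟩
  have HS := Hθ η hηB' K hK S hSsub hSnear
  constructor
  · intro c hc hband
    have h1 := HS c hc (Or.inr hband)
    have h2 := HFε η hηF' K hK Sf hSfsub hSffar c hc hband
    rw [sum_sum_powerset_eq_pivotal_add_proper hkpos m F η 1 c]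
    -- abbreviation of the proper defect of a bundle
    obtain ⟨Df, hDf⟩ : ∃ Df : Site 2 × Fin 2 × Fin 3 → ℝ, ∀ i,
        ∑ J ∈ ((Finset.range k).powerset).erase (Finset.range k), (M k 1 c).real
          ({ω | ω \ edgeOf '' {vd : Site 2 × Fin 2 | ax k vd ∧ tb k vd = i.1 ∧ vd.2 = i.2.1} ∪
            ↑(J.image fun j : ℕ => edgeOf ((fun l => (k : ℤ) * i.1 l + if l = i.2.1 then (j : ℤ) else 0),
              i.2.1)) ∈ Aloc m F η} \ {ω | ω \ edgeOf '' {vd : Site 2 × Fin 2 | ax k vd ∧ tb k vd = i.1 ∧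
            vd.2 = i.2.1} ∈ Aloc m F η}) = Df i := ⟨_, fun _ => rfl⟩
    simp only [hDf] at h1 h2 ⊢
    have hsplit : ∑ i ∈ K with i.2.2 = 2, Df i = ∑ i ∈ S, Df i + ∑ i ∈ Sf, Df i := by
      rw [hS_def, hSf_def]
      exact (Finset.sum_filter_add_sum_filter_not _ _ _).symm
    rw [hsplit]
    linarith
  · have hN : 0 ≤ ∑ i ∈ K with i.2.2 = 2, (M k 1 0).real {ω | ω ∪ edgeOf '' {vd : Site 2 × Fin 2 | ax k vd ∧
        tb k vd = i.1 ∧ vd.2 = i.2.1} ∈ Aloc m F η ∧ ω \ edgeOf '' {vd : Site 2 × Fin 2 | ax k vd ∧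
        tb k vd = i.1 ∧ vd.2 = i.2.1} ∉ Aloc m F η} := Finset.sum_nonneg fun i _ => measureReal_nonneg
    have Hc := HS 0 ⟨le_rfl, zero_le_one⟩ (Or.inl rfl)
    rw [sum_sum_powerset_eq_of_far_c0 hkpos F hη0 1 hSsub hfar]
    nlinarith [Hc, mul_nonneg hε.le hN]

end Summit.CriticalPhenomena.CardyFormulaZ2.Theorems.CardySelfRefinement

end
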